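/-
Copyright (c) 2026 the pub-hodgecm-mathlib formalisation cell (harness21).  Prover seat hodgecm-mathlib-F0P2-p10 (g4), Track B ∕ R90-TF, h413 = `stmt-HodgeConjecture-24833`,
R90-TF section S8 «ContSpec-n½», socket (E) `sock_S8_res_exhaustion_le_closure` (B ED. 7 :276) via ★ `res_exhaustion_le_closure_of_record`: THE GLUE OVER `K_∞`-TYPES FROM τ-CUT BLOCKS —
the (N₃) whole-block letter `hNblk Kf b` from per-type letters stated at the τ-CUT BLOCK `Sc ⊓ N_τ` (the output shape of the τ-edition of D5′ with the τ-cut projector `e_τ ∘L R_f(e)`)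
(S8 dealer R90-CS-plan (g3) S8-R247 (3); census `K2/K2E1-p14/g4/CENSUS-E4-PlancherelEstate.K2E1-p14-g4.md` row (1); K-TYPE CURRENCY FLAG S8-R189).
-/
import Summits.HodgeConjecture.HodgeConjecture.Theorems.R90S8ResGIsotypicArchLevelBridgeU3   -- ★ (K2E1-p14 (g4)): `inf_le_orthogonal_of_isotypic_cut`, `orthogonal_stable_of_stable`; brings ★ `restrict_archInfUnitaryOne_apply_mem_resGBlock`, ★ `starProjection_isotypicComponent_mem'`, ★ G-DEFS
import Summits.HodgeConjecture.HodgeConjecture.Theorems.R90S8ResGIsotypicKTypeGlueU3         -- ★ (K2E1-p14 (g4)): `hNblk_of_kTypes` (Peter–Weyl inside `W ⊓ Fix(ι_f Kf)`); brings ★ `compactSpace_arch_inf_unitaryOne`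
import Summits.HodgeConjecture.HodgeConjecture.Theorems.K2E1CuspidalSpectrumUnitaryDefs      -- ★ `residualSubspace`
import HarnessLib

/-!
# S8 (E) road — `R90S8ResExhaustionGlueOverKTypesU3`: the (N₃) letter of the block of record FROM ITS τ-CUT BLOCKS `Sc ⊓ N_τ` — `hNblk_of_tauCuts`

Track B ∕ R90-TF, crux h413 = `stmt-HodgeConjecture-24833`, route of record `HCCMUnconditional`; cell `hodgecm-mathlib`, R90-TF programme, section S8 «ContSpec-n½», socket (E)
(B ED. 7 :276) through ★ `res_exhaustion_le_closure_of_record` ∕ ★ `hNblk_of_record` (K2E1-p14), whose (N₃) row is the whole-block letter `hNblk Kf b`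
(`W ⊓ Fix(ι_f Kf) ≤ (Sc ⊓ Aᗮ)ᗮ` for every irreducible residual `W`).  By the K-TYPE CURRENCY FLAG (S8-R189) that row is paid PER `K_∞`-TYPE `τ`: the τ-edition of D5′ (projector
`Pr_τ = e_τ ∘L R_f(e)`, `e_τ` the `χ_τ`-idempotent of K2E1-p16 (g4)'s `R90S8ResGIsotypicTauIdempotentModelU3`; its `hScP` row ★ `hScP_tauCut_of_record`) speaks about the τ-CUT BLOCK
`Sc_τ := Sc ⊓ N_τ` (`N_τ` the τ-isotypic component of `ρ = R ∘ ι_∞|_{K_∞}`, `K_∞ = U(J₃)(L⁺⊗ℝ) ∩ U(1⊗1)` through the κ OF RECORD), and delivers, per `τ`, the orthogonality of the irreducible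
residual `W ⊓ Fix(ι_f Kf)` to the line part `Sc_τ ⊓ Aᗮ` of the τ-cut block.  THIS FILE glues those per-τ-cut letters into `hNblk` (census-E4 row (1) «PAID PER `K_∞`-TYPE τ and GLUED»).
THEOREMS ONLY (no `def`, no `instance`, no `notation`, no named-fact hypothesis, no `sorry`; default heartbeats); lane `--supports stmt-HodgeConjecture-24833 --as helper` (count-neutral).
CLOSES NO SOCKET.

THE MATHEMATICS ([BrockerTomDieck1985, III (5.7), Thm. (5.10)]; [DeitmarEchterhoff2014, Prop. 7.3.3, §7.3]; [BorelJacquet1979, §4.1, §4.6]).  Two steps, both ★: (i) ISOTYPIC CUT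
(★ `inf_le_orthogonal_of_isotypic_cut` with `Sc′ := Sc ⊓ N_τ`, `A′ := A`, `Wf = Wf′ := W ⊓ Fix(ι_f Kf)`): the orthogonal projection `P_τ` onto `N_τ` preserves the CLOSED `K_∞`-STABLE subspaces
`Sc` (★ `isClosed_resGBlock`, ★ `restrict_archInfUnitaryOne_apply_mem_resGBlock` — `χ₂` automorphic) and `Aᗮ` (`A` `K_∞`-stable, the visible letter `hAstab`; ★ `orthogonal_stable_of_stable`),
so for `x ∈ Sc ⊓ Aᗮ` and `w ∈ W ⊓ Fix(ι_f Kf) ⊓ N_τ`: `⟪x, w⟫ = ⟪P_τ x, w⟫ + ⟪x − P_τ x, w⟫ = 0 + 0`, the first by the τ-cut letter (`P_τ x ∈ Sc_τ ⊓ Aᗮ`), the second because `x − P_τ x ⟂ N_τ`;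
this is the per-type letter `hτ` of ★ `hNblk_of_kTypes` (`W ⊓ (Fix(ι_f Kf) ⊓ N_τ) ≤ (Sc ⊓ Aᗮ)ᗮ`).  (ii) PETER–WEYL inside `W ⊓ Fix(ι_f Kf)` (★ `hNblk_of_kTypes`) sums the types.
* **`hτ_of_tauCut`** — ONE type: the τ-cut letter `W ⊓ Fix(ι_f Kf) ≤ (Sc ⊓ N_τ ⊓ Aᗮ)ᗮ` ⊢ the `hτ` bytes of ★ `hNblk_of_kTypes` (letters: `hAstab`; `χ₂` automorphic).
* **`hNblk_of_tauCuts`** — ALL types: the family of τ-cut letters ⊢ the `hNblk Kf b` BYTES of ★ `res_exhaustion_le_closure_of_record` ∕ ★ `hNblk_of_record` (= ★ `hNblk_of_kTypes`' conclusion).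
HONEST LABEL: HC_CM is proved only modulo the 7 printed citations (2 remaining named inputs: hLiu418 = `stmt-HodgeConjecture-24832`, h413 = `stmt-HodgeConjecture-24833`) until
rung 0 closes; REL ≠ ★ ≠ BUILT; this file asserts no named fact, is conditional on its visible per-τ-cut letters (the τ-edition of D5′, K2E1-p16's road) and `hAstab`, and closes no socket;
(E) :276 stays ★ OF RECORD modulo {(HEAD₃) L, E1-Plancherel XL, per-block glue} — this file is the «glue» entry only; count-neutral.

## References
* [BrockerTomDieck1985] T. Bröcker, T. tom Dieck, *Representations of Compact Lie Groups*, GTM 98 (1985), III (5.7), Thm. (5.10).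
* [DeitmarEchterhoff2014] A. Deitmar, S. Echterhoff, *Principles of Harmonic Analysis* (2nd ed., 2014), Prop. 7.3.3, §7.3.
* [BorelJacquet1979] A. Borel, H. Jacquet, *Automorphic forms and automorphic representations*, PSPM 33.1 (1979), §4.1, §4.6.
-/

set_option autoImplicit false
set_option linter.dupNamespace false  -- the mandated namespace `…HodgeConjecture.HodgeConjecture.R90.S8` (LEAD #1 L1) repeats the summit's segment

noncomputable section

open MeasureTheory Filter Topology NumberField ContRepresentation Set
open scoped InnerProductSpace ENNReal NNReal
open Literature.NumberTheory.Automorphic Literature.NumberTheory.Automorphic.UnitaryGroup Literature.NumberTheory.GaloisRepresentations AdelicGroupData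
open Literature.NumberTheory.Automorphic.Arthur2013.Leaves.TECR
open Summit.HodgeConjecture.HodgeConjecture.Cruxes.H413.K2E1CuspidalSpectrumUnitary (residualSubspace)

namespace Summit.HodgeConjecture.HodgeConjecture.R90.S8

variable (L : Type) [Field L] [NumberField L] [IsCMField L]
  (μ : Measure (quasiSplit (↥(maximalRealSubfield L)) L (IsCMField.complexConj L) 3).automorphicQuotient) [(quasiSplit (↥(maximalRealSubfield L)) L (IsCMField.complexConj L) 3).IsAutomorphicMeasure μ]

/-- **ONE TYPE — the per-type letter `hτ` of ★ `hNblk_of_kTypes` FROM THE τ-CUT LETTER.**  At the block of record `Sc = resGBlock L μ (ι_f Kf) 1 χ₁ χ₂` (`Kf` open `≤ K₀`, `χ₂` automorphic),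
a `K_∞`-STABLE residue space `A` (`hAstab`) and an irreducible closed `K_∞`-subrepresentation `τ` with isotypic component `N_τ`: if a closed subrepresentation `W` (any) satisfies the τ-CUT letter
`W ⊓ Fix(ι_f Kf) ≤ (Sc ⊓ N_τ ⊓ Aᗮ)ᗮ` (the output of the τ-edition of D5′ at the τ-cut block), then `W ⊓ (Fix(ι_f Kf) ⊓ N_τ) ≤ (Sc ⊓ Aᗮ)ᗮ` — ★ `inf_le_orthogonal_of_isotypic_cut` with
`Sc′ := Sc ⊓ N_τ`, `A′ := A`, `Wf = Wf′ := W ⊓ Fix(ι_f Kf)`, `P_τ` preserving `Sc` (★) and `Aᗮ` (★ `orthogonal_stable_of_stable`). [cite: DeitmarEchterhoff2014, Prop. 7.3.3]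
[cite: BorelJacquet1979, §4.6] -/
theorem hτ_of_tauCut (Kf : {Kf : Subgroup ↥(finAdelic (↥(maximalRealSubfield L)) L (IsCMField.complexConj L) 3 ((StdForm.antidiagonal 3).over L)) // IsOpen ((Kf : Subgroup ↥(finAdelic (↥(maximalRealSubfield L)) L (IsCMField.complexConj L) 3 ((StdForm.antidiagonal 3).over L))) : Set ↥(finAdelic (↥(maximalRealSubfield L)) L (IsCMField.complexConj L) 3 ((StdForm.antidiagonal 3).over L))) ∧ Kf ≤ ((((standardMaximalCompactGL 3 L).comap (adelicVal (↥(maximalRealSubfield L)) L (IsCMField.complexConj L) 3 ((StdForm.antidiagonal 3).over L)) : Subgroup (quasiSplit (↥(maximalRealSubfield L)) L (IsCMField.complexConj L) 3).Adelic)).comap (finAdelicToAdelic (↥(maximalRealSubfield L)) L (IsCMField.complexConj L) 3 ((StdForm.antidiagonal 3).over L)) : Subgroup ↥(finAdelic (↥(maximalRealSubfield L)) L (IsCMField.complexConj L) 3 ((StdForm.antidiagonal 3).over L)))})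
    (χ₁ : HeckeCharacter L) {χ₂ : ↥(TorusDict.torus (IsCMField.complexConj L)) →ₜ* ℂˣ} (hχ₂ : TorusDict.IsAutomorphic (IsCMField.complexConj L) χ₂)
    (τ : {U : ClosedSubrep (((quasiSplit (↥(maximalRealSubfield L)) L (IsCMField.complexConj L) 3).rightRegular μ).restrict ((archToAdelic (↥(maximalRealSubfield L)) L (IsCMField.complexConj L) 3 ((StdForm.antidiagonal 3).over L)).comp (Subgroup.inclusion (inf_le_left : (UnitaryGroup.arch (↥(maximalRealSubfield L)) L (IsCMField.complexConj L) 3 ((StdForm.antidiagonal 3).over L) ⊓ unitaryGroupOfForm (conjMixed (↥(maximalRealSubfield L)) L (IsCMField.complexConj L)) 1) ≤ UnitaryGroup.arch (↥(maximalRealSubfield L)) L (IsCMField.complexConj L) 3 ((StdForm.antidiagonal 3).over L))))) // U.toContRep.IsTopIrreducible})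
    (A : Submodule ℂ ((quasiSplit (↥(maximalRealSubfield L)) L (IsCMField.complexConj L) 3).L2 μ)) (hAstab : ∀ (k : ↥(UnitaryGroup.arch (↥(maximalRealSubfield L)) L (IsCMField.complexConj L) 3 ((StdForm.antidiagonal 3).over L) ⊓ unitaryGroupOfForm (conjMixed (↥(maximalRealSubfield L)) L (IsCMField.complexConj L)) 1)), ∀ v ∈ A, (((quasiSplit (↥(maximalRealSubfield L)) L (IsCMField.complexConj L) 3).rightRegular μ).restrict ((archToAdelic (↥(maximalRealSubfield L)) L (IsCMField.complexConj L) 3 ((StdForm.antidiagonal 3).over L)).comp (Subgroup.inclusion (inf_le_left : (UnitaryGroup.arch (↥(maximalRealSubfield L)) L (IsCMField.complexConj L) 3 ((StdForm.antidiagonal 3).over L) ⊓ unitaryGroupOfForm (conjMixed (↥(maximalRealSubfield L)) L (IsCMField.complexConj L)) 1) ≤ UnitaryGroup.arch (↥(maximalRealSubfield L)) L (IsCMField.complexConj L) 3 ((StdForm.antidiagonal 3).over L))))) k v ∈ A)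
    (W : ClosedSubrep ((quasiSplit (↥(maximalRealSubfield L)) L (IsCMField.complexConj L) 3).rightRegular μ))
    (hcutτ : W.toSubmodule ⊓ (⨅ u : ↥(Kf.1), Module.End.eigenspace ((((quasiSplit (↥(maximalRealSubfield L)) L (IsCMField.complexConj L) 3).rightRegular μ) (finAdelicToAdelic (↥(maximalRealSubfield L)) L (IsCMField.complexConj L) 3 ((StdForm.antidiagonal 3).over L) (u : ↥(finAdelic (↥(maximalRealSubfield L)) L (IsCMField.complexConj L) 3 ((StdForm.antidiagonal 3).over L)))) :
        (quasiSplit (↥(maximalRealSubfield L)) L (IsCMField.complexConj L) 3).L2 μ →L[ℂ] (quasiSplit (↥(maximalRealSubfield L)) L (IsCMField.complexConj L) 3).L2 μ) : (quasiSplit (↥(maximalRealSubfield L)) L (IsCMField.complexConj L) 3).L2 μ →ₗ[ℂ] (quasiSplit (↥(maximalRealSubfield L)) L (IsCMField.complexConj L) 3).L2 μ) 1) ≤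
      (resGBlock L μ (Kf.1.map (finAdelicToAdelic (↥(maximalRealSubfield L)) L (IsCMField.complexConj L) 3 ((StdForm.antidiagonal 3).over L))) 1 χ₁ χ₂ ⊓ ((((quasiSplit (↥(maximalRealSubfield L)) L (IsCMField.complexConj L) 3).rightRegular μ).restrict ((archToAdelic (↥(maximalRealSubfield L)) L (IsCMField.complexConj L) 3 ((StdForm.antidiagonal 3).over L)).comp (Subgroup.inclusion (inf_le_left : (UnitaryGroup.arch (↥(maximalRealSubfield L)) L (IsCMField.complexConj L) 3 ((StdForm.antidiagonal 3).over L) ⊓ unitaryGroupOfForm (conjMixed (↥(maximalRealSubfield L)) L (IsCMField.complexConj L)) 1) ≤ UnitaryGroup.arch (↥(maximalRealSubfield L)) L (IsCMField.complexConj L) 3 ((StdForm.antidiagonal 3).over L))))).isotypicComponent τ.1.toContRep).toSubmodule ⊓ Aᗮ)ᗮ) :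
    W.toSubmodule ⊓ ((⨅ u : ↥(Kf.1), Module.End.eigenspace ((((quasiSplit (↥(maximalRealSubfield L)) L (IsCMField.complexConj L) 3).rightRegular μ) (finAdelicToAdelic (↥(maximalRealSubfield L)) L (IsCMField.complexConj L) 3 ((StdForm.antidiagonal 3).over L) (u : ↥(finAdelic (↥(maximalRealSubfield L)) L (IsCMField.complexConj L) 3 ((StdForm.antidiagonal 3).over L)))) :
        (quasiSplit (↥(maximalRealSubfield L)) L (IsCMField.complexConj L) 3).L2 μ →L[ℂ] (quasiSplit (↥(maximalRealSubfield L)) L (IsCMField.complexConj L) 3).L2 μ) : (quasiSplit (↥(maximalRealSubfield L)) L (IsCMField.complexConj L) 3).L2 μ →ₗ[ℂ] (quasiSplit (↥(maximalRealSubfield L)) L (IsCMField.complexConj L) 3).L2 μ) 1) ⊓ ((((quasiSplit (↥(maximalRealSubfield L)) L (IsCMField.complexConj L) 3).rightRegular μ).restrict ((archToAdelic (↥(maximalRealSubfield L)) L (IsCMField.complexConj L) 3 ((StdForm.antidiagonal 3).over L)).comp (Subgroup.inclusion (inf_le_left : (UnitaryGroup.arch (↥(maximalRealSubfield L)) L (IsCMField.complexConj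 L) 3 ((StdForm.antidiagonal 3).over L) ⊓ unitaryGroupOfForm (conjMixed (↥(maximalRealSubfield L)) L (IsCMField.complexConj L)) 1) ≤ UnitaryGroup.arch (↥(maximalRealSubfield L)) L (IsCMField.complexConj L) 3 ((StdForm.antidiagonal 3).over L))))).isotypicComponent τ.1.toContRep).toSubmodule) ≤ (resGBlock L μ (Kf.1.map (finAdelicToAdelic (↥(maximalRealSubfield L)) L (IsCMField.complexConj L) 3 ((StdForm.antidiagonal 3).over L))) 1 χ₁ χ₂ ⊓ Aᗮ)ᗮ := by
  have hρ : (((quasiSplit (↥(maximalRealSubfield L)) L (IsCMField.complexConj L) 3).rightRegular μ).restrict ((archToAdelic (↥(maximalRealSubfield L)) L (IsCMField.complexConj L) 3 ((StdForm.antidiagonal 3).over L)).comp (Subgroup.inclusion (inf_le_left : (UnitaryGroup.arch (↥(maximalRealSubfield L)) L (IsCMField.complexConj L) 3 ((StdForm.antidiagonal 3).over L) ⊓ unitaryGroupOfForm (conjMixed (↥(maximalRealSubfield L)) L (IsCMField.complexConj L)) 1) ≤ UnitaryGroup.arch (↥(maximalRealSubfield L)) L (IsCMField.complexConj L) 3 ((StdForm.antidiagonal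 3).over L))))).IsUnitary := fun k => ((quasiSplit (↥(maximalRealSubfield L)) L (IsCMField.complexConj L) 3).isUnitary_rightRegular μ) _
  rw [← inf_assoc]
  exact inf_le_orthogonal_of_isotypic_cut ((((quasiSplit (↥(maximalRealSubfield L)) L (IsCMField.complexConj L) 3).rightRegular μ).restrict ((archToAdelic (↥(maximalRealSubfield L)) L (IsCMField.complexConj L) 3 ((StdForm.antidiagonal 3).over L)).comp (Subgroup.inclusion (inf_le_left : (UnitaryGroup.arch (↥(maximalRealSubfield L)) L (IsCMField.complexConj L) 3 ((StdForm.antidiagonal 3).over L) ⊓ unitaryGroupOfForm (conjMixed (↥(maximalRealSubfield L)) L (IsCMField.complexConj L)) 1) ≤ UnitaryGroup.arch (↥(maximalRealSubfield L)) L (IsCMField.complexConj L) 3 ((StdForm.antidiagonal 3).over L))))).isotypicComponent τ.1.toContRep).toSubmodule _ A _ A _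
    (W.toSubmodule ⊓ (⨅ u : ↥(Kf.1), Module.End.eigenspace ((((quasiSplit (↥(maximalRealSubfield L)) L (IsCMField.complexConj L) 3).rightRegular μ) (finAdelicToAdelic (↥(maximalRealSubfield L)) L (IsCMField.complexConj L) 3 ((StdForm.antidiagonal 3).over L) (u : ↥(finAdelic (↥(maximalRealSubfield L)) L (IsCMField.complexConj L) 3 ((StdForm.antidiagonal 3).over L)))) :
        (quasiSplit (↥(maximalRealSubfield L)) L (IsCMField.complexConj L) 3).L2 μ →L[ℂ] (quasiSplit (↥(maximalRealSubfield L)) L (IsCMField.complexConj L) 3).L2 μ) : (quasiSplit (↥(maximalRealSubfield L)) L (IsCMField.complexConj L) 3).L2 μ →ₗ[ℂ] (quasiSplit (↥(maximalRealSubfield L)) L (IsCMField.complexConj L) 3).L2 μ) 1))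
    (fun x hx => starProjection_isotypicComponent_mem' hρ (isClosed_resGBlock L μ _ 1 χ₁ χ₂)
      (fun k v hv => restrict_archInfUnitaryOne_apply_mem_resGBlock L μ Kf.1 χ₁ hχ₂ k hv) hx)
    (fun x hx => starProjection_isotypicComponent_mem' hρ (Submodule.isClosed_orthogonal A)
      (fun k v hv => orthogonal_stable_of_stable hρ A hAstab k hv) hx)
    le_rfl le_rfl inf_le_left hcutτ

/-- **ALL TYPES — `hNblk_of_tauCuts`: THE (N₃) WHOLE-BLOCK LETTER FROM THE τ-CUT LETTERS.**  Same data; if for EVERY irreducible closed `K_∞`-subrepresentation `τ` and every irreducible residual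
`W` the τ-cut letter `W ⊓ Fix(ι_f Kf) ≤ (Sc ⊓ N_τ ⊓ Aᗮ)ᗮ` holds (the per-τ output of the τ-edition of D5′ with the τ-cut projector `e_τ ∘L R_f(e)`, K2E1-p16's road; 1-dimensional types
equally served), then `W ⊓ Fix(ι_f Kf) ≤ (Sc ⊓ Aᗮ)ᗮ` for every irreducible residual `W` — the `hNblk Kf b` BYTES of ★ `res_exhaustion_le_closure_of_record` ∕ ★ `hNblk_of_record` (★ `hNblk_of_kTypes`
∘ `hτ_of_tauCut`: Peter–Weyl inside `W ⊓ Fix(ι_f Kf)`). [cite: BrockerTomDieck1985, III (5.7), Thm. (5.10)] [cite: DeitmarEchterhoff2014, Prop. 7.3.3, §7.3] [cite: BorelJacquet1979, §4.1, §4.6] -/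
theorem hNblk_of_tauCuts (𝔓 : (quasiSplit (↥(maximalRealSubfield L)) L (IsCMField.complexConj L) 3).ParabolicUnipotentData) (Kf : {Kf : Subgroup ↥(finAdelic (↥(maximalRealSubfield L)) L (IsCMField.complexConj L) 3 ((StdForm.antidiagonal 3).over L)) // IsOpen ((Kf : Subgroup ↥(finAdelic (↥(maximalRealSubfield L)) L (IsCMField.complexConj L) 3 ((StdForm.antidiagonal 3).over L))) : Set ↥(finAdelic (↥(maximalRealSubfield L)) L (IsCMField.complexConj L) 3 ((StdForm.antidiagonal 3).over L))) ∧ Kf ≤ ((((standardMaximalCompactGL 3 L).comap (adelicVal (↥(maximalRealSubfield L)) L (IsCMField.complexConj L) 3 ((StdForm.antidiagonal 3).over L)) : Subgroup (quasiSplit (↥(maximalRealSubfield L)) L (IsCMField.complexConj L) 3).Adelic)).comap (finAdelicToAdelic (↥(maximalRealSubfield L)) L (IsCMField.complexConj L) 3 ((StdForm.antidiagonal 3).over L)) : Subgroup ↥(finAdelic (↥(maximalRealSubfield L)) L (IsCMField.complexConj L) 3 ((StdForm.antidiagonal 3).over L)))})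
    (χ₁ : HeckeCharacter L) {χ₂ : ↥(TorusDict.torus (IsCMField.complexConj L)) →ₜ* ℂˣ} (hχ₂ : TorusDict.IsAutomorphic (IsCMField.complexConj L) χ₂)
    (A : Submodule ℂ ((quasiSplit (↥(maximalRealSubfield L)) L (IsCMField.complexConj L) 3).L2 μ)) (hAstab : ∀ (k : ↥(UnitaryGroup.arch (↥(maximalRealSubfield L)) L (IsCMField.complexConj L) 3 ((StdForm.antidiagonal 3).over L) ⊓ unitaryGroupOfForm (conjMixed (↥(maximalRealSubfield L)) L (IsCMField.complexConj L)) 1)), ∀ v ∈ A, (((quasiSplit (↥(maximalRealSubfield L)) L (IsCMField.complexConj L) 3).rightRegular μ).restrict ((archToAdelic (↥(maximalRealSubfield L)) L (IsCMField.complexConj L) 3 ((StdForm.antidiagonal 3).over L)).comp (Subgroup.inclusion (inf_le_left : (UnitaryGroup.arch (↥(maximalRealSubfield L)) L (IsCMField.complexConj L) 3 ((StdForm.antidiagonal 3).over L) ⊓ unitaryGroupOfForm (conjMixed (↥(maximalRealSubfield L)) L (IsCMField.complexConj L)) 1) ≤ UnitaryGroup.arch (↥(maximalRealSubfield L)) L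 (IsCMField.complexConj L) 3 ((StdForm.antidiagonal 3).over L))))) k v ∈ A)
    (hcut : ∀ (τ : {U : ClosedSubrep (((quasiSplit (↥(maximalRealSubfield L)) L (IsCMField.complexConj L) 3).rightRegular μ).restrict ((archToAdelic (↥(maximalRealSubfield L)) L (IsCMField.complexConj L) 3 ((StdForm.antidiagonal 3).over L)).comp (Subgroup.inclusion (inf_le_left : (UnitaryGroup.arch (↥(maximalRealSubfield L)) L (IsCMField.complexConj L) 3 ((StdForm.antidiagonal 3).over L) ⊓ unitaryGroupOfForm (conjMixed (↥(maximalRealSubfield L)) L (IsCMField.complexConj L)) 1) ≤ UnitaryGroup.arch (↥(maximalRealSubfield L)) L (IsCMField.complexConj L) 3 ((StdForm.antidiagonal 3).over L))))) // U.toContRep.IsTopIrreducible}) (W : ClosedSubrep ((quasiSplit (↥(maximalRealSubfield L)) L (IsCMField.complexConj L) 3).rightRegular μ)), W.toContRep.IsTopIrreducible → W ≤ residualSubspace (quasiSplit (↥(maximalRealSubfield L)) L (IsCMField.complexConj L) 3) μ 𝔓 →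
      W.toSubmodule ⊓ (⨅ u : ↥(Kf.1), Module.End.eigenspace ((((quasiSplit (↥(maximalRealSubfield L)) L (IsCMField.complexConj L) 3).rightRegular μ) (finAdelicToAdelic (↥(maximalRealSubfield L)) L (IsCMField.complexConj L) 3 ((StdForm.antidiagonal 3).over L) (u : ↥(finAdelic (↥(maximalRealSubfield L)) L (IsCMField.complexConj L) 3 ((StdForm.antidiagonal 3).over L)))) :
        (quasiSplit (↥(maximalRealSubfield L)) L (IsCMField.complexConj L) 3).L2 μ →L[ℂ] (quasiSplit (↥(maximalRealSubfield L)) L (IsCMField.complexConj L) 3).L2 μ) : (quasiSplit (↥(maximalRealSubfield L)) L (IsCMField.complexConj L) 3).L2 μ →ₗ[ℂ] (quasiSplit (↥(maximalRealSubfield L)) L (IsCMField.complexConj L) 3).L2 μ) 1) ≤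
        (resGBlock L μ (Kf.1.map (finAdelicToAdelic (↥(maximalRealSubfield L)) L (IsCMField.complexConj L) 3 ((StdForm.antidiagonal 3).over L))) 1 χ₁ χ₂ ⊓ ((((quasiSplit (↥(maximalRealSubfield L)) L (IsCMField.complexConj L) 3).rightRegular μ).restrict ((archToAdelic (↥(maximalRealSubfield L)) L (IsCMField.complexConj L) 3 ((StdForm.antidiagonal 3).over L)).comp (Subgroup.inclusion (inf_le_left : (UnitaryGroup.arch (↥(maximalRealSubfield L)) L (IsCMField.complexConj L) 3 ((StdForm.antidiagonal 3).over L) ⊓ unitaryGroupOfForm (conjMixed (↥(maximalRealSubfield L)) L (IsCMField.complexConj L)) 1) ≤ UnitaryGroup.arch (↥(maximalRealSubfield L)) L (IsCMField.complexConj L) 3 ((StdForm.antidiagonal 3).over L))))).isotypicComponent τ.1.toContRep).toSubmodule ⊓ Aᗮ)ᗮ) :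
    ∀ (W : ClosedSubrep ((quasiSplit (↥(maximalRealSubfield L)) L (IsCMField.complexConj L) 3).rightRegular μ)), W.toContRep.IsTopIrreducible → W ≤ residualSubspace (quasiSplit (↥(maximalRealSubfield L)) L (IsCMField.complexConj L) 3) μ 𝔓 →
      W.toSubmodule ⊓ (⨅ u : ↥(Kf.1), Module.End.eigenspace ((((quasiSplit (↥(maximalRealSubfield L)) L (IsCMField.complexConj L) 3).rightRegular μ) (finAdelicToAdelic (↥(maximalRealSubfield L)) L (IsCMField.complexConj L) 3 ((StdForm.antidiagonal 3).over L) (u : ↥(finAdelic (↥(maximalRealSubfield L)) L (IsCMField.complexConj L) 3 ((StdForm.antidiagonal 3).over L)))) :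
        (quasiSplit (↥(maximalRealSubfield L)) L (IsCMField.complexConj L) 3).L2 μ →L[ℂ] (quasiSplit (↥(maximalRealSubfield L)) L (IsCMField.complexConj L) 3).L2 μ) : (quasiSplit (↥(maximalRealSubfield L)) L (IsCMField.complexConj L) 3).L2 μ →ₗ[ℂ] (quasiSplit (↥(maximalRealSubfield L)) L (IsCMField.complexConj L) 3).L2 μ) 1) ≤ (resGBlock L μ (Kf.1.map (finAdelicToAdelic (↥(maximalRealSubfield L)) L (IsCMField.complexConj L) 3 ((StdForm.antidiagonal 3).over L))) 1 χ₁ χ₂ ⊓ Aᗮ)ᗮ :=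
  hNblk_of_kTypes L μ 𝔓 Kf χ₁ χ₂ A fun τ W hW hres => hτ_of_tauCut L μ Kf χ₁ hχ₂ τ A hAstab W (hcut τ W hW hres)

end Summit.HodgeConjecture.HodgeConjecture.R90.S8

end
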